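import Mathlib.AlgebraicGeometry.Restrict
import Mathlib.AlgebraicGeometry.OpenImmersion
import HarnessLib

/-!
# Mutually inverse partial morphisms restrict to an open immersion
(crux `FrobeniusLadder.FRationalResolution`, line `Sketch`, theme REC)

Stub `isOpenImmersion_of_mutual_inverse` of the skeleton `Sketch` for crux
stmt-ResolutionOfSingularities-15317: the purely formal last step of "isomorphic stalks give
isomorphic open neighbourhoods".

Data: opens `A₁ ≤ U₁` of `X` and `B₁ ≤ V₁` of `Y`; morphisms `f : U₁ ⟶ Y`, `g : V₁ ⟶ X`;
a restriction `φ : A₁ ⟶ V₁` of `f` (`φ ≫ V₁.ι = homOfLE ≫ f`) and a restriction `ψ : B₁ ⟶ U₁`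
of `g`, such that `g ∘ φ` is the inclusion of `A₁` and `f ∘ ψ` is the inclusion of `B₁`.

Conclusion: on `A₂ := A₁.ι ''ᵁ (φ ⁻¹ᵁ (V₁.ι ⁻¹ᵁ B₁))` (the points of `A₁` that `φ` sends into `B₁`)
the composite `A₂ ⟶ A₁ ⟶ V₁ ⟶ Y` is an open immersion.

Proof: with `B₂ := B₁.ι ''ᵁ (ψ ⁻¹ᵁ (U₁.ι ⁻¹ᵁ A₁))`, the composite `jA : A₂ ⟶ Y` has range inside
`B₂` (`range_subset_range_ι_of_mutual_inverse`), so it lifts through the open immersion `B₂.ι`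
(`IsOpenImmersion.lift`); symmetrically `jB : B₂ ⟶ X` lifts through `A₂.ι`, and the two lifts are
mutually inverse (`lift_comp_lift_of_mutual_inverse`, a `cancel_mono` computation using
`g ∘ φ = A₁.ι`). Hence `jA = (iso) ≫ B₂.ι` is an open immersion.
-/

set_option linter.dupNamespace false

noncomputable section

namespace Summit.ResolutionOfSingularities.ResolutionOfSingularities.Theorems.FRationalResolution

open CategoryTheory AlgebraicGeometry TopologicalSpace

universe u

/-- The composite `A₂ ⟶ A₁ ⟶ V₁ ⟶ Y`, where `A₂ ⊆ A₁` is the locus that `φ` maps into `B₁`, has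
range inside `B₂ := B₁.ι ''ᵁ (ψ ⁻¹ᵁ (U₁.ι ⁻¹ᵁ A₁))`, provided `ψ` is a restriction of `g` and
`g ∘ φ` is the inclusion of `A₁`. -/
theorem range_subset_range_ι_of_mutual_inverse {X Y : Scheme.{u}} (U₁ A₁ : X.Opens)
    (V₁ B₁ : Y.Opens) (hB : B₁ ≤ V₁) (g : (V₁ : Scheme.{u}) ⟶ X)
    (φ : (A₁ : Scheme.{u}) ⟶ (V₁ : Scheme.{u})) (ψ : (B₁ : Scheme.{u}) ⟶ (U₁ : Scheme.{u}))
    (hψ : ψ ≫ U₁.ι = Y.homOfLE hB ≫ g) (h₁ : φ ≫ g = A₁.ι) :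
    Set.range (X.homOfLE (A₁.ι_image_le (φ ⁻¹ᵁ (V₁.ι ⁻¹ᵁ B₁))) ≫ φ ≫ V₁.ι) ⊆
      Set.range (B₁.ι ''ᵁ (ψ ⁻¹ᵁ (U₁.ι ⁻¹ᵁ A₁))).ι := by
  rw [Scheme.Opens.range_ι]
  rintro _ ⟨a, rfl⟩
  have ha : (a.1 : X) ∈ A₁.ι ''ᵁ (φ ⁻¹ᵁ (V₁.ι ⁻¹ᵁ B₁)) := a.2
  obtain ⟨a', ha', e⟩ := ha
  -- `a` viewed in `A₁` is `a'`
  have hX : X.homOfLE (A₁.ι_image_le (φ ⁻¹ᵁ (V₁.ι ⁻¹ᵁ B₁))) a = a' := by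
    apply A₁.ι.isOpenEmbedding.injective
    rw [← Scheme.Hom.comp_apply, Scheme.homOfLE_ι]
    exact e.symm
  rw [Scheme.Hom.comp_apply, Scheme.Hom.comp_apply, hX]
  -- `φ a'` lies in `B₁`; call the corresponding point `b`
  have hb : (V₁.ι (φ a') : Y) ∈ B₁ := ha'
  refine ⟨⟨V₁.ι (φ a'), hb⟩, ?_, rfl⟩
  -- `ψ b` lies over `A₁` since `ψ b = g (φ a') = a'`
  show U₁.ι (ψ ⟨V₁.ι (φ a'), hb⟩) ∈ A₁
  have hV : Y.homOfLE hB ⟨V₁.ι (φ a'), hb⟩ = φ a' := by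
    apply V₁.ι.isOpenEmbedding.injective
    rw [← Scheme.Hom.comp_apply, Scheme.homOfLE_ι]
    rfl
  rw [← Scheme.Hom.comp_apply, hψ, Scheme.Hom.comp_apply, hV, ← Scheme.Hom.comp_apply, h₁]
  exact a'.2

/-- The lift `A₂ ⟶ B₂` of `A₂ ⟶ Y` through `B₂.ι`, followed by the lift `B₂ ⟶ A₂` of `B₂ ⟶ X`
through `A₂.ι`, is the identity: after composing with the monomorphism `A₂.ι` both sides become
`A₂ ⟶ A₁ ⟶ V₁ ⟶ X = A₂.ι` (using `g ∘ φ = A₁.ι`). -/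
theorem lift_comp_lift_of_mutual_inverse {X Y : Scheme.{u}} (U₁ A₁ : X.Opens)
    (V₁ B₁ : Y.Opens) (hB : B₁ ≤ V₁) (g : (V₁ : Scheme.{u}) ⟶ X)
    (φ : (A₁ : Scheme.{u}) ⟶ (V₁ : Scheme.{u})) (ψ : (B₁ : Scheme.{u}) ⟶ (U₁ : Scheme.{u}))
    (hψ : ψ ≫ U₁.ι = Y.homOfLE hB ≫ g) (h₁ : φ ≫ g = A₁.ι)
    (hrA : Set.range (X.homOfLE (A₁.ι_image_le (φ ⁻¹ᵁ (V₁.ι ⁻¹ᵁ B₁))) ≫ φ ≫ V₁.ι) ⊆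
      Set.range (B₁.ι ''ᵁ (ψ ⁻¹ᵁ (U₁.ι ⁻¹ᵁ A₁))).ι)
    (hrB : Set.range (Y.homOfLE (B₁.ι_image_le (ψ ⁻¹ᵁ (U₁.ι ⁻¹ᵁ A₁))) ≫ ψ ≫ U₁.ι) ⊆
      Set.range (A₁.ι ''ᵁ (φ ⁻¹ᵁ (V₁.ι ⁻¹ᵁ B₁))).ι) :
    IsOpenImmersion.lift (B₁.ι ''ᵁ (ψ ⁻¹ᵁ (U₁.ι ⁻¹ᵁ A₁))).ι _ hrA ≫
      IsOpenImmersion.lift (A₁.ι ''ᵁ (φ ⁻¹ᵁ (V₁.ι ⁻¹ᵁ B₁))).ι _ hrB = 𝟙 _ := by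
  -- the lift `A₂ ⟶ B₂` followed by `B₂ ⟶ V₁` is `A₂ ⟶ A₁ ⟶ V₁`
  have key : IsOpenImmersion.lift (B₁.ι ''ᵁ (ψ ⁻¹ᵁ (U₁.ι ⁻¹ᵁ A₁))).ι _ hrA ≫
      Y.homOfLE ((B₁.ι_image_le (ψ ⁻¹ᵁ (U₁.ι ⁻¹ᵁ A₁))).trans hB) =
        X.homOfLE (A₁.ι_image_le (φ ⁻¹ᵁ (V₁.ι ⁻¹ᵁ B₁))) ≫ φ := by
    rw [← cancel_mono V₁.ι, Category.assoc, Scheme.homOfLE_ι, IsOpenImmersion.lift_fac,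
      Category.assoc]
  rw [← cancel_mono (A₁.ι ''ᵁ (φ ⁻¹ᵁ (V₁.ι ⁻¹ᵁ B₁))).ι, Category.assoc,
    IsOpenImmersion.lift_fac, Category.id_comp, hψ, Scheme.homOfLE_homOfLE_assoc,
    reassoc_of% key, h₁, Scheme.homOfLE_ι]

/-- W14-INV: two partial morphisms between open subschemes that are mutually inverse where
defined restrict to an open immersion -/
theorem isOpenImmersion_of_mutual_inverse {X Y : Scheme.{0}} (U₁ A₁ : X.Opens) (V₁ B₁ : Y.Opens)
    (hA : A₁ ≤ U₁) (hB : B₁ ≤ V₁) (f : (U₁ : Scheme.{0}) ⟶ Y) (g : (V₁ : Scheme.{0}) ⟶ X)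
    (φ : (A₁ : Scheme.{0}) ⟶ (V₁ : Scheme.{0})) (ψ : (B₁ : Scheme.{0}) ⟶ (U₁ : Scheme.{0}))
    (hφ : φ ≫ V₁.ι = X.homOfLE hA ≫ f) (hψ : ψ ≫ U₁.ι = Y.homOfLE hB ≫ g)
    (h₁ : φ ≫ g = A₁.ι) (h₂ : ψ ≫ f = B₁.ι) :
    IsOpenImmersion (X.homOfLE (A₁.ι_image_le (φ ⁻¹ᵁ (V₁.ι ⁻¹ᵁ B₁))) ≫ φ ≫ V₁.ι) := by
  have hrA := range_subset_range_ι_of_mutual_inverse U₁ A₁ V₁ B₁ hB g φ ψ hψ h₁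
  have hrB := range_subset_range_ι_of_mutual_inverse V₁ B₁ U₁ A₁ hA f ψ φ hφ h₂
  haveI : IsIso (IsOpenImmersion.lift (B₁.ι ''ᵁ (ψ ⁻¹ᵁ (U₁.ι ⁻¹ᵁ A₁))).ι _ hrA) :=
    ⟨⟨IsOpenImmersion.lift (A₁.ι ''ᵁ (φ ⁻¹ᵁ (V₁.ι ⁻¹ᵁ B₁))).ι _ hrB,
      lift_comp_lift_of_mutual_inverse U₁ A₁ V₁ B₁ hB g φ ψ hψ h₁ hrA hrB,
      lift_comp_lift_of_mutual_inverse V₁ B₁ U₁ A₁ hA f ψ φ hφ h₂ hrB hrA⟩⟩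
  rw [← IsOpenImmersion.lift_fac (B₁.ι ''ᵁ (ψ ⁻¹ᵁ (U₁.ι ⁻¹ᵁ A₁))).ι _ hrA]
  infer_instance

end Summit.ResolutionOfSingularities.ResolutionOfSingularities.Theorems.FRationalResolution

end
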